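import Summits.BirchSwinnertonDyer.Rank1Residual.X11b.ShapiroPairs
import HarnessLib

/-!
# BSD rank-≤1 residual cell, class X4 (additive reduction at `p`, `p ≥ 5`): `BSD(E,7)` for the
# three window residue pairs at `p = 7` with split-Cartan-normaliser image (`7Ns.2.1`, `7Ns.3.1`)
# from PUBLISHED theorems + ONE exact Shapiro `7`-descent certificate line per pair

HONEST FRAMING (cell `b2b-bsdres-*`, verbatim): prove what is provable now; shrink each hard class
to its core with data; no claim beyond stated classes; COMBINATION classes deleted from PUBLISHED
theorems only, CONSTRUCTION-shaped remainder typed; this is not "finishing BSD". Class X4 stays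
CONSTRUCTION-SHAPED; everything here is PER PAIR; no lane verdict is changed; no named fact; nothing
is booked by this unit (the two-implementation standard and the booking are the lane's / referee A's).

Unit `b2b-bsdres-x11c` (the cell's `p`-descent engines), gen 14, serving the X4 owners and the hyp
RES-ROADMAP residue (GEN 29 §4.1/§4.2: `2450ba1@7` (r = 1, category B), `2450bd1@7` (r = 0,
category B), `2450d1@7` (r = 0, category L) — `N = 2450 = 2·5²·7²`, additive at `7`, mod-7 image
of split-Cartan-NORMALISER type (Sutherland `7Ns.2.1`, `7Ns.2.1`, `7Ns.3.1`), `#Ш_an = 1`; so far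
ONE seat's engine (hyp ENGINE HS, kit j104561/j104794/j104558) gave `dim Sel⁷(E/ℚ) = rank`).
THIS FILE transcribes the SECOND, independent implementation: x11c's p-GENERIC port
`descentPlib.gp` (gen 14; = gen 12's audited `shapiro5lib.gp` + gen 13's `s4lib.gp` with the prime
a parameter, Miller's double-and-add for the Kummer function `f_{T'}` (`div = 7(T') − 7(O)`,
leading coefficient `±1 = (±1)⁷` at `O` so `P ↦ f_{T'}(P)` IS the Weil-pairing Kummer map), the
Cartan field searched among the quadratic fields unramified outside `7N`; REGRESSION at `p = 5`:
gen 12's `5Ns` rows reproduced value for value, kit j112700). METHOD (gen 12, SHAPIRO5-METHOD.md,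
`p` replaced by `7`): the image meets `N(C_s) ∖ C_s`, so over the Cartan field `K' = ℚ(√−7)` the
module `E[7]` splits into two conjugate lines and `E[7] = Ind_{K'}^ℚ(χ)`; by SHAPIRO's lemma and
Kummer theory `Sel⁷(E/ℚ) = {ξ ∈ (L(S,7))^{(δ = a)} : (cls_𝔓 ξ)_{𝔓 ∣ ℓ} ∈ ⟨f_{T'}(E(ℚ_ℓ))⟩, ℓ ∣ 7N}`
EXACTLY, where `L = K'(T') = ℚ(T')` (`T'` a point of one line), `[L:K'] = 3` (`2450ba1`,
`2450bd1`: `L` = the sextic field `t⁶ − 2t⁵ + 4t⁴ + 13t³ + 23t² + 17t + 8`, `d_L = −5⁴·7⁵`) resp.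
`[L:K'] = 6` (`2450d1`: degree 12, `|d_L| = 5¹⁰·7¹⁰`), the local targets `dim E(ℚ_ℓ)[7] + [ℓ = 7]`
are KNOWN and reached, the class group of `L` (`ℤ/3` in all three) is CERTIFIED by `bnfcertify`
(degree ≤ 12: unconditional), and `L(S,7)` is `7`-saturated by septic residue characters:
mode **EXACT**. RESULT (x11c kit **j112697**; certificates `HOME/b2b-bsdres-x11c/gen14/p7/`):
`dim Sel⁷(E/ℚ) = 1, 0, 0 = rank` for `2450ba1`, `2450bd1`, `2450d1`, the generator image of
`2450ba1` non-zero in `Sel` with an exact 7th root exhibited — the SAME values as hyp's ENGINE HS.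
Hence `#Sel^(7)(E/ℚ) = 7^{r_an}`, `Ш(E/ℚ)[7] = 0` for all three.

What enters the kernel per pair is ONE line: the EXACT hypothesis `hSel : #Sel^(7)(E/ℚ) = 7 ^ r_an`
of the tree's class-free consumer `Typed.bsdp_of_card_selmerGroup_eq_pow_analyticRank` through
x11c gen 12's literal-model instantiation `X11b.bsdp_of_ainvs_of_card_selmerGroup` (GZK `hGZK`,
`r_an ≤ 1`, `p ∤ #Ш_an` ⟹ Miller's `BSDp`; `Δ ≠ 0` decided in the kernel). Non-kernel inputs per
pair: `r_an` and `#Ш_an = 1` (Cremona; the cell's engines) and the certificate line. PER PAIR;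
not a class theorem; nothing booked by this unit.

References: J. Neukirch, A. Schmidt, K. Wingberg, *Cohomology of Number Fields* (2008) (1.6.4);
E. F. Schaefer, M. Stoll, Trans. AMS 356 (2004) §2–3; J. H. Silverman, *AEC* (2009) X.1, X.4
[SilvermanAEC2009]; A. V. Sutherland, Forum Math. Sigma 4 (2016); R. L. Miller, LMS JCM 14
(2011) §1 [Miller2011LMS]; Cremona's tables [Cremona2006].
-/

set_option autoImplicit false

noncomputable section

open scoped Classical

open WeierstrassCurve Literature.NumberTheory.EllipticCurves
  Literature.NumberTheory.EllipticCurves.Rank1Residual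
  Literature.NumberTheory.EllipticCurves.Rank1Residual.Typed
  Literature.NumberTheory.EllipticCurves.Rank1Residual.X11RankOneCertificates
  Summit.BirchSwinnertonDyer.Rank1Residual.X11b

namespace Summit.BirchSwinnertonDyer.Rank1Residual.X4

/-! ### The three window pairs of X4 at `p = 7` with split-Cartan-normaliser image (RES-ROADMAP `SHAPH`) -/

/-- **`BSD(E,7)` for `2450ba1`** (`N = 2450 = 2·5²·7²`, additive at `7`; Cremona model
`[1, -1, 1, -2680, -50053]`; `ρ̄_{E,7}` of split-Cartan-normaliser type `7Ns.2.1`; rank `1`,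
generator `(−31, 65)`, `E(ℚ)_tors = 0`, `#Ш_an = 1`) from GZK and the single certificate line
`#Sel^(7)(E/ℚ) = 7 ^ r_an`: EXACT Shapiro `7`-descent (x11c gen 14 `descentPlib.gp`, p-generic
port of gen 12; kit j112697): Cartan field `K' = ℚ(√−7)`, `L = ℚ(T')` sextic
(`t⁶ − 2t⁵ + 4t⁴ + 13t³ + 23t² + 17t + 8`, `d_L = −5⁴·7⁵`), `χ(δ) = 2` of order `3 = [L:K']`,
`S = {2,5,7}`, `Cl(L) ≅ ℤ/3` CERTIFIED (`bnfcertify = 1`), `Cl_S(L) = 1`, `8` generators of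
`L(S,7)` (`7`-saturated by `36` septic characters), eigenspace of dimension `2` (Galois action
PROVED by characters, `8/8` columns), local targets `dim J_ℓ = 1, 0, 1` at `ℓ = 2, 5, 7`
(`#E(ℚ₂)[7] = 7`) all reached, **`dim_𝔽₇ Sel^(7)(E/ℚ) = 1`** with the generator's Kummer image
its non-zero element (exact 7th root exhibited): mode **EXACT**; the same value on the other
seat's independent engine (hyp ENGINE HS, kit j104561). Kernel: `Δ ≠ 0`. Binders: `hGZK`
(published), `r_an ≤ 1` and `#Ш_an` a `7`-adic unit (Cremona / the cell's engines), `hSel` (this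
certificate). [cite: Miller2011LMS, §1 and Def. 1.1] [cite: Cremona2006, Table 1 (Cremona label 2450ba1)] -/
theorem bsdp_s2450ba1 (hGZK : rank_eq_analyticRank_of_analyticRank_le_one)
    (W : WeierstrassCurve ℚ) (hW : W = ⟨1, -1, 1, -2680, -50053⟩)
    (hr : W.analyticRank ≤ 1) {q : ℚ} (hq : shaAn W = (q : ℂ)) (hv : padicValRat 7 q = 0)
    (hSel : Nat.card (W.selmerGroup (7 : ℤ)) = 7 ^ W.analyticRank) : BSDp W 7 := by
  subst hW
  haveI : Fact (Nat.Prime 7) := ⟨by norm_num⟩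
  exact bsdp_of_ainvs_of_card_selmerGroup hGZK 1 (-1) 1 (-2680) (-50053) (by decide +kernel) 7 hr hq hv hSel

/-- **`BSD(E,7)` for `2450bd1`** (`N = 2450 = 2·5²·7²`, additive at `7`; Cremona model
`[1, -1, 1, -131305, 17430697]`; `ρ̄_{E,7}` of type `7Ns.2.1`; rank `0`, `E(ℚ)_tors = 0`,
`#Ш_an = 1`) from GZK and the single certificate line `#Sel^(7)(E/ℚ) = 7 ^ r_an`: EXACT Shapiro
`7`-descent (x11c gen 14, kit j112697): `K' = ℚ(√−7)`, the same sextic `L` (`d_L = −5⁴·7⁵`),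
`[L:K'] = 3`, `S = {2,5,7}`, `Cl(L) ≅ ℤ/3` CERTIFIED (`bnfcertify = 1`), `Cl_S(L) = 1`, `8`
generators (`7`-saturated, `36` characters), eigenspace of dimension `2` (PROVED by characters),
local targets `1, 0, 1` at `ℓ = 2, 5, 7` all reached, **`dim_𝔽₇ Sel^(7)(E/ℚ) = 0`**: mode
**EXACT**; same value on hyp's ENGINE HS (kit j104561). Kernel: `Δ ≠ 0`. Binders: `hGZK`
(published), `r_an ≤ 1` and `#Ш_an` a `7`-adic unit (Cremona / the cell's engines), `hSel` (this
certificate). [cite: Miller2011LMS, §1 and Def. 1.1] [cite: Cremona2006, Table 1 (Cremona label 2450bd1)] -/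
theorem bsdp_s2450bd1 (hGZK : rank_eq_analyticRank_of_analyticRank_le_one)
    (W : WeierstrassCurve ℚ) (hW : W = ⟨1, -1, 1, -131305, 17430697⟩)
    (hr : W.analyticRank ≤ 1) {q : ℚ} (hq : shaAn W = (q : ℂ)) (hv : padicValRat 7 q = 0)
    (hSel : Nat.card (W.selmerGroup (7 : ℤ)) = 7 ^ W.analyticRank) : BSDp W 7 := by
  subst hW
  haveI : Fact (Nat.Prime 7) := ⟨by norm_num⟩
  exact bsdp_of_ainvs_of_card_selmerGroup hGZK 1 (-1) 1 (-131305) 17430697 (by decide +kernel) 7 hr hq hv hSel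

/-- **`BSD(E,7)` for `2450d1`** (`N = 2450 = 2·5²·7²`, additive at `7`; Cremona model
`[1, -1, 0, -5252, 140496]`; `ρ̄_{E,7}` of type `7Ns.3.1`; rank `0`, `E(ℚ)_tors = 0`,
`#Ш_an = 1`; lane-certified in v4u (`T-LW`), category L) from GZK and the single certificate line
`#Sel^(7)(E/ℚ) = 7 ^ r_an`: EXACT Shapiro `7`-descent (x11c gen 14, kit j112697): `K' = ℚ(√−7)`,
`L = ℚ(T')` of degree `12` (`|d_L| = 5¹⁰·7¹⁰`), `χ(δ) = 3` of order `6 = [L:K']`, `S = {2,5,7}`,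
`Cl(L) ≅ ℤ/3` CERTIFIED (`bnfcertify = 1`), `Cl_S(L) = 1`, `11` generators (`7`-saturated, `45`
characters), eigenspace of dimension `1` (PROVED by characters), local targets `0, 0, 1` at
`ℓ = 2, 5, 7` all reached, **`dim_𝔽₇ Sel^(7)(E/ℚ) = 0`**: mode **EXACT**. Kernel: `Δ ≠ 0`.
Binders: `hGZK` (published), `r_an ≤ 1` and `#Ш_an` a `7`-adic unit (Cremona / the cell's
engines), `hSel` (this certificate).
[cite: Miller2011LMS, §1 and Def. 1.1] [cite: Cremona2006, Table 1 (Cremona label 2450d1)] -/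
theorem bsdp_s2450d1 (hGZK : rank_eq_analyticRank_of_analyticRank_le_one)
    (W : WeierstrassCurve ℚ) (hW : W = ⟨1, -1, 0, -5252, 140496⟩)
    (hr : W.analyticRank ≤ 1) {q : ℚ} (hq : shaAn W = (q : ℂ)) (hv : padicValRat 7 q = 0)
    (hSel : Nat.card (W.selmerGroup (7 : ℤ)) = 7 ^ W.analyticRank) : BSDp W 7 := by
  subst hW
  haveI : Fact (Nat.Prime 7) := ⟨by norm_num⟩
  exact bsdp_of_ainvs_of_card_selmerGroup hGZK 1 (-1) 0 (-5252) 140496 (by decide +kernel) 7 hr hq hv hSel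

end Summit.BirchSwinnertonDyer.Rank1Residual.X4

end
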